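import Mathlib
import Literature.Analysis.FluidPDE.VectorCalculus
import Summits.NavierStokesRegularity.NavierStokesRegularity.Theorems.FilamentSkeletonRssMatchedKernelDirectionalDeriv
import Summits.NavierStokesRegularity.NavierStokesRegularity.Theorems.FilamentSkeletonRssSelectionBoxRJRungDivFreeTrace

/-!
# The MATCHED-CORE skeleton field is divergence-free and its frame velocity has trace `3/2`
# (variable cores `mₖ(u) ≥ m₀ > 0` along the filaments)

Sequel to `…MatchedKernelDifferentiable` / `…MatchedKernelDirectionalDeriv`.  Port of the constant-core census
`…SelectionBoxRJRungDivFreeTrace` (lane 19175-p1 g6) to the matched kernel of the A1G cone (kit §5(d) μ-parametrised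
restatements):

* `matchedBiotSavart_sum_inner_fderiv_eq_zero` — for ONE filament with core profile `m` (continuous, `m ≥ m₀ > 0`),
  the matched-core Biot–Savart field `F(y) = ∫ ((‖y − X u‖² + m u)^{3/2})⁻¹ • X′(u) × (y − X u) du` is divergence-free
  in the kernel's own terms: `Σᵢ ⟪bᵢ, DF(y) bᵢ⟫ = 0` for every orthonormal basis `b` of `ℝ³` (pointwise trace of the
  derivative integrand = 0, `SelectionBoxRJRung.sum_inner_gradIntegrand_eq_zero`, kernel-free);
* `matchedSkeletonField_trace_eq` — hence for the frame velocity of an `N`-filament skeleton with per-filament core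
  profiles `m k` (common floor `m₀`), `v = Σₖ cₖ Fₖ + ½ id − α e₃ × ·`: `Σᵢ ⟪bᵢ, Dv(x) bᵢ⟫ = 3/2` for every orthonormal
  basis — in particular `v` is differentiable everywhere (`matchedSkeletonField_differentiableAt`).

With the kernel-free `SelectionBoxRJRung.normalBlock_trace_eq/neg` and `…box_eigenvector_law` this yields the TRACE HALF of
clause 12 for matched cores (next file).  Lane ns-filament-19175-p1 g11; `--supports stmt-NavierStokesRegularity-27849`.
HONEST FRAMING: calculus for a HYPOTHETICAL filament skeleton on the NEGATIVE side of a MODEL route; nothing here bears on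
Navier–Stokes regularity or blow-up.
-/

set_option linter.dupNamespace false

noncomputable section

namespace Summit.NavierStokesRegularity.NavierStokesRegularity.Theorems.MatchedKernel

open Set Function Filter MeasureTheory Real
open Literature.Analysis.FluidPDE
open Summit.NavierStokesRegularity.NavierStokesRegularity.Theorems.SelectionBoxRJRung
open scoped InnerProductSpace Topology

/-- **The matched-core Biot–Savart field of a filament is divergence-free** (trace form): with a core profile `m`
continuous, `m ≥ m₀ > 0`, a `C¹` filament with `‖X′‖ ≤ 1` and linear growth `c|u| − C ≤ ‖X u‖`, for every point `y`
and every orthonormal basis `b` of `ℝ³`, `Σᵢ ⟪bᵢ, (fderiv F y) bᵢ⟫ = 0`. [folklore] -/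
theorem matchedBiotSavart_sum_inner_fderiv_eq_zero {ι : Type*} [Fintype ι] {m : ℝ → ℝ} {m₀ c C : ℝ}
    {X : ℝ → EuclideanSpace ℝ (Fin 3)} (hm₀ : 0 < m₀) (hm : ∀ u, m₀ ≤ m u) (hmc : Continuous m) (hc : 0 < c)
    (hX : ContDiff ℝ 1 X) (hdX : ∀ u, ‖deriv X u‖ ≤ 1) (hgrow : ∀ u, c * |u| - C ≤ ‖X u‖)
    (b : OrthonormalBasis ι ℝ (EuclideanSpace ℝ (Fin 3))) (y : EuclideanSpace ℝ (Fin 3)) :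
    ∑ i, ⟪b i, fderiv ℝ (fun y : EuclideanSpace ℝ (Fin 3) => ∫ u : ℝ,
        ((‖y - X u‖ ^ 2 + m u) ^ (3 / 2 : ℝ))⁻¹ • cross (deriv X u) (y - X u)) y (b i)⟫_ℝ = 0 := by
  have happ : ∀ i, fderiv ℝ (fun y : EuclideanSpace ℝ (Fin 3) => ∫ u : ℝ,
        ((‖y - X u‖ ^ 2 + m u) ^ (3 / 2 : ℝ))⁻¹ • cross (deriv X u) (y - X u)) y (b i) =
      ∫ u : ℝ, ((-3 * ⟪y - X u, b i⟫_ℝ * ((‖y - X u‖ ^ 2 + m u) ^ (5 / 2 : ℝ))⁻¹) • cross (deriv X u) (y - X u)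
        + ((‖y - X u‖ ^ 2 + m u) ^ (3 / 2 : ℝ))⁻¹ • cross (deriv X u) (b i)) :=
    fun i => matchedBiotSavart_fderiv_apply_eq hm₀ hm hmc hc hX hdX hgrow y (b i)
  have hint : ∀ i, Integrable (fun u : ℝ =>
      (-3 * ⟪y - X u, b i⟫_ℝ * ((‖y - X u‖ ^ 2 + m u) ^ (5 / 2 : ℝ))⁻¹) • cross (deriv X u) (y - X u)
        + ((‖y - X u‖ ^ 2 + m u) ^ (3 / 2 : ℝ))⁻¹ • cross (deriv X u) (b i)) :=
    fun i => (matchedBiotSavart_directionalDeriv hm₀ hm hmc hc hX hdX hgrow y (b i)).1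
  simp_rw [happ]
  have hinner : ∀ i, ⟪b i, ∫ u : ℝ,
      ((-3 * ⟪y - X u, b i⟫_ℝ * ((‖y - X u‖ ^ 2 + m u) ^ (5 / 2 : ℝ))⁻¹) • cross (deriv X u) (y - X u)
        + ((‖y - X u‖ ^ 2 + m u) ^ (3 / 2 : ℝ))⁻¹ • cross (deriv X u) (b i))⟫_ℝ =
      ∫ u : ℝ, ⟪b i, (-3 * ⟪y - X u, b i⟫_ℝ * ((‖y - X u‖ ^ 2 + m u) ^ (5 / 2 : ℝ))⁻¹) •
          cross (deriv X u) (y - X u) + ((‖y - X u‖ ^ 2 + m u) ^ (3 / 2 : ℝ))⁻¹ • cross (deriv X u) (b i)⟫_ℝ :=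
    fun i => (integral_inner (hint i) (b i)).symm
  simp_rw [hinner]
  rw [← integral_finsetSum _ (fun i _ => (hint i).const_inner (b i))]
  have hzero : ∀ u : ℝ, ∑ i, ⟪b i, (-3 * ⟪y - X u, b i⟫_ℝ * ((‖y - X u‖ ^ 2 + m u) ^ (5 / 2 : ℝ))⁻¹) •
        cross (deriv X u) (y - X u) + ((‖y - X u‖ ^ 2 + m u) ^ (3 / 2 : ℝ))⁻¹ • cross (deriv X u) (b i)⟫_ℝ = 0 := by
    intro u
    have h := sum_inner_gradIntegrand_eq_zero b (-3 * ((‖y - X u‖ ^ 2 + m u) ^ (5 / 2 : ℝ))⁻¹)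
      (((‖y - X u‖ ^ 2 + m u) ^ (3 / 2 : ℝ))⁻¹) (deriv X u) (y - X u)
    have hre : ∀ i, -3 * ⟪y - X u, b i⟫_ℝ * ((‖y - X u‖ ^ 2 + m u) ^ (5 / 2 : ℝ))⁻¹ =
        -3 * ((‖y - X u‖ ^ 2 + m u) ^ (5 / 2 : ℝ))⁻¹ * ⟪y - X u, b i⟫_ℝ := fun i => by ring
    simp_rw [hre]
    exact h
  simp_rw [hzero]
  exact integral_zero _ _

/-- **Trace of the matched-core frame-velocity gradient.**  Let `v y = Σₖ cₖ • Fₖ y + ½ y − α e₃ × y` where each `Fₖ`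
is the matched-core Biot–Savart field of a `C¹` filament `Xₖ` (`‖Xₖ′‖ ≤ 1`, linear growth) with core profile `mₖ`
(continuous, common floor `m₀ > 0`).  Then for every `x` and every orthonormal basis `b` of `ℝ³`:
`Σᵢ ⟪bᵢ, (fderiv v x) bᵢ⟫ = 3/2`. [folklore] -/
theorem matchedSkeletonField_trace_eq {ι : Type*} [Fintype ι] {N : ℕ} {m : Fin N → ℝ → ℝ} {m₀ c₀ α : ℝ}
    {C : Fin N → ℝ} {coef : Fin N → ℝ} {X : Fin N → ℝ → EuclideanSpace ℝ (Fin 3)}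
    (hm₀ : 0 < m₀) (hm : ∀ k u, m₀ ≤ m k u) (hmc : ∀ k, Continuous (m k)) (hc₀ : 0 < c₀)
    (hX : ∀ k, ContDiff ℝ 1 (X k)) (hdX : ∀ k u, ‖deriv (X k) u‖ ≤ 1) (hgrow : ∀ k u, c₀ * |u| - C k ≤ ‖X k u‖)
    (b : OrthonormalBasis ι ℝ (EuclideanSpace ℝ (Fin 3))) (x : EuclideanSpace ℝ (Fin 3)) :
    ∑ i, ⟪b i, fderiv ℝ (fun y : EuclideanSpace ℝ (Fin 3) =>
        (∑ k, coef k • ∫ u : ℝ, ((‖y - X k u‖ ^ 2 + m k u) ^ (3 / 2 : ℝ))⁻¹ • cross (deriv (X k) u) (y - X k u))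
          + (1 / 2 : ℝ) • y - α • cross (EuclideanSpace.single 2 1) y) x (b i)⟫_ℝ = 3 / 2 := by
  set F : Fin N → EuclideanSpace ℝ (Fin 3) → EuclideanSpace ℝ (Fin 3) := fun k y =>
    ∫ u : ℝ, ((‖y - X k u‖ ^ 2 + m k u) ^ (3 / 2 : ℝ))⁻¹ • cross (deriv (X k) u) (y - X k u) with hF
  have hdiff : ∀ k, DifferentiableAt ℝ (F k) x := fun k =>
    (matchedBiotSavart_differentiable hm₀ (hm k) (hmc k) hc₀ (hX k) (hdX k) (hgrow k)) x
  set Lrot : EuclideanSpace ℝ (Fin 3) →L[ℝ] EuclideanSpace ℝ (Fin 3) :=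
    crossCLM (EuclideanSpace.single (2 : Fin 3) (1 : ℝ)) with hLrot
  set M : EuclideanSpace ℝ (Fin 3) →L[ℝ] EuclideanSpace ℝ (Fin 3) :=
    (1 / 2 : ℝ) • ContinuousLinearMap.id ℝ _ - α • Lrot with hM
  have hMapp : ∀ y, M y = (1 / 2 : ℝ) • y - α • cross (EuclideanSpace.single 2 1) y := fun y => by
    simp [hM, hLrot]
  have hsum : HasFDerivAt (fun y : EuclideanSpace ℝ (Fin 3) => ∑ k, coef k • F k y)
      (∑ k, coef k • fderiv ℝ (F k) x) x :=
    HasFDerivAt.fun_sum fun k _ => ((hdiff k).hasFDerivAt).const_smul (coef k)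
  have hlin : HasFDerivAt (fun y : EuclideanSpace ℝ (Fin 3) =>
      (1 / 2 : ℝ) • y - α • cross (EuclideanSpace.single 2 1) y) M x := by
    have hf : (fun y : EuclideanSpace ℝ (Fin 3) => (1 / 2 : ℝ) • y - α • cross (EuclideanSpace.single 2 1) y) =
        fun y => M y := funext fun y => (hMapp y).symm
    rw [hf]
    exact M.hasFDerivAt
  have htot := hsum.add hlin
  have hfd : fderiv ℝ (fun y : EuclideanSpace ℝ (Fin 3) =>
        (∑ k, coef k • F k y) + ((1 / 2 : ℝ) • y - α • cross (EuclideanSpace.single 2 1) y)) x =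
      (∑ k, coef k • fderiv ℝ (F k) x) + M := htot.fderiv
  have hfun : (fun y : EuclideanSpace ℝ (Fin 3) =>
        (∑ k, coef k • ∫ u : ℝ, ((‖y - X k u‖ ^ 2 + m k u) ^ (3 / 2 : ℝ))⁻¹ • cross (deriv (X k) u) (y - X k u))
          + (1 / 2 : ℝ) • y - α • cross (EuclideanSpace.single 2 1) y) =
      fun y => (∑ k, coef k • F k y) + ((1 / 2 : ℝ) • y - α • cross (EuclideanSpace.single 2 1) y) := by
    funext y; simp only [hF]; abel
  rw [hfun, hfd]
  have hdiv : ∀ k, ∑ i, ⟪b i, fderiv ℝ (F k) x (b i)⟫_ℝ = 0 := fun k =>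
    matchedBiotSavart_sum_inner_fderiv_eq_zero hm₀ (hm k) (hmc k) hc₀ (hX k) (hdX k) (hgrow k) b x
  have hrot : ∀ i, ⟪b i, cross (EuclideanSpace.single (2 : Fin 3) (1 : ℝ)) (b i)⟫_ℝ = 0 := fun i => by
    rw [real_inner_comm (cross _ (b i)) (b i)]
    simp [cross, crossProduct, PiLp.inner_apply, Fin.sum_univ_three]; ring
  have hid : ∑ i, ⟪b i, b i⟫_ℝ = (3 : ℝ) := by
    have : ∀ i, ⟪b i, b i⟫_ℝ = 1 := fun i => by
      rw [real_inner_self_eq_norm_sq, b.orthonormal.1 i, one_pow]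
    simp_rw [this]
    rw [Finset.sum_const, Finset.card_univ, nsmul_eq_mul, mul_one]
    have hcard : Fintype.card ι = 3 := by
      have h := Module.finrank_eq_card_basis b.toBasis
      rw [finrank_euclideanSpace_fin] at h
      exact h.symm
    exact_mod_cast hcard
  have hterm : ∀ i, ⟪b i, ((∑ k, coef k • fderiv ℝ (F k) x) + M) (b i)⟫_ℝ =
      (∑ k, coef k * ⟪b i, fderiv ℝ (F k) x (b i)⟫_ℝ) +
        ((1 / 2 : ℝ) * ⟪b i, b i⟫_ℝ - α * ⟪b i, cross (EuclideanSpace.single (2 : Fin 3) (1 : ℝ)) (b i)⟫_ℝ) := by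
    intro i
    have happly : ((∑ k, coef k • fderiv ℝ (F k) x) + M) (b i) = (∑ k, coef k • fderiv ℝ (F k) x (b i)) + M (b i) := by
      simp
    rw [happly, hMapp, inner_add_right, inner_sum, inner_sub_right, real_inner_smul_right, real_inner_smul_right]
    congr 1
    exact Finset.sum_congr rfl fun k _ => real_inner_smul_right _ _ _
  simp_rw [hterm, hrot, mul_zero, sub_zero]
  rw [Finset.sum_add_distrib, Finset.sum_comm, ← Finset.mul_sum, hid]
  simp_rw [← Finset.mul_sum, hdiv, mul_zero, Finset.sum_const_zero]
  norm_num

/-- The matched-core frame velocity is differentiable at every point (a by-product of the trace computation: the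
basis-trace `3/2 ≠ 0` forces `DifferentiableAt`, else `fderiv = 0`). [folklore] -/
theorem matchedSkeletonField_differentiableAt {N : ℕ} {m : Fin N → ℝ → ℝ} {m₀ c₀ α : ℝ} {C : Fin N → ℝ}
    {coef : Fin N → ℝ} {X : Fin N → ℝ → EuclideanSpace ℝ (Fin 3)}
    (hm₀ : 0 < m₀) (hm : ∀ k u, m₀ ≤ m k u) (hmc : ∀ k, Continuous (m k)) (hc₀ : 0 < c₀)
    (hX : ∀ k, ContDiff ℝ 1 (X k)) (hdX : ∀ k u, ‖deriv (X k) u‖ ≤ 1) (hgrow : ∀ k u, c₀ * |u| - C k ≤ ‖X k u‖)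
    (x : EuclideanSpace ℝ (Fin 3)) :
    DifferentiableAt ℝ (fun y : EuclideanSpace ℝ (Fin 3) =>
        (∑ k, coef k • ∫ u : ℝ, ((‖y - X k u‖ ^ 2 + m k u) ^ (3 / 2 : ℝ))⁻¹ • cross (deriv (X k) u) (y - X k u))
          + (1 / 2 : ℝ) • y - α • cross (EuclideanSpace.single 2 1) y) x := by
  by_contra h
  have h1 := matchedSkeletonField_trace_eq (coef := coef) (α := α) hm₀ hm hmc hc₀ hX hdX hgrow
    (EuclideanSpace.basisFun (Fin 3) ℝ) x
  rw [fderiv_zero_of_not_differentiableAt h] at h1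
  norm_num at h1

end Summit.NavierStokesRegularity.NavierStokesRegularity.Theorems.MatchedKernel
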